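import Summits.QuantumFields.YangMills.Theorems.BalabanUVNodesN11GaussianCertificateDefs
import Literature.MathematicalPhysics.QuantumFieldTheory.Balaban1983to89.Node00.Record13SepCoPHChi
import Literature.MathematicalPhysics.QuantumFieldTheory.Balaban1983to89.Node00.Record13ResidualsRChi
import Summits.QuantumFields.YangMills.Theorems.BalabanUVNodesN11HistoryPinnedResidualDefsChi
import Summits.QuantumFields.YangMills.Theorems.BalabanUVNodesN11RePinnedParamDefsChi
import Summits.QuantumFields.YangMills.Theorems.BalabanUVNodesN11BackgroundScaleLocalChi
import Summits.QuantumFields.YangMills.Theorems.BalabanUVNodesN11GaussianCertificateRowsChi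
import Summits.QuantumFields.YangMills.Theorems.BalabanUVNodesN11NoExpansionAtRecord13CoPChi
import Summits.QuantumFields.YangMills.Theorems.BalabanUVNodesN11NoExpansionDiagonalCoPHChi
import Summits.QuantumFields.YangMills.Theorems.BalabanUVNodesN11NoExpansionOldFactorsChi
import Summits.QuantumFields.YangMills.Theorems.BalabanUVNodesN11NoExpansionGeneralStepCoPHOldBranchChi
import Summits.QuantumFields.YangMills.Theorems.BalabanUVNodesN11NoExpansionGeneralStepGraphChi
import Summits.QuantumFields.YangMills.Theorems.BalabanUVNodesN11DiagonalOldBranchMeasurableChi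
import Summits.QuantumFields.YangMills.Theorems.BalabanUVNodesN11OldBranchPairChi
import Summits.QuantumFields.YangMills.Theorems.BalabanUVNodesN11TruncationDominationChi

/-!
# χ-GENERIC RE-ISSUE (WORK ORDER RC-1 «RE-CENTRE THE RECORD», director-ym №462 (B) ∕ №467 (D)) of `BalabanUVNodesN11GaussianCertificateDefs`

Cell `pub-ymgap` (HUMAN RULING D-0062, Track A), seat `pub-ymgap-dag-n11-d` (N11 [B14] s2; N11-σ campaign, `N11-G44-RC1-REACH-CENSUS.md`).  The CENTRE-TYPED
declarations of `BalabanUVNodesN11GaussianCertificateDefs` (those whose statement reads the (2.9) cut-off centre through `gOfRecord₁₃ ∕ EOfRecord₁₃ ∕ Provisos₁₃… ∕ T∕SLaw₁₃… ∕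
UbgOfRecord₁₃… ∕ WtOfRecord₁₃… ∕ datum∕tower∕coreOfRecord₁₃…`) RE-ISSUED VERBATIM in the β-slot `χ : ChiSlot F N` over [Ax-3b]∕[Ax-3c]∕[Ax-3d]'s χ-generic carriers
(`Node00/Record13Chi` ∕ `Record13CoPHChi` ∕ `Record13SepCoPHChi`): σ = (binder `(χ : ChiSlot F N)` after `θ`; Node00 defs `X ↦ XChi … χ`; Node00 rows `Y ↦ Y_chi`;
this lane's sibling modules `…Chi` for Summits-side dependencies); SAME short names in the sibling namespace `…BalabanUVNodesN11GaussianCertificateDefsChi` (consumers switch by namespace);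
the 11 centre-FREE declarations of the original are NOT copied — they are reused BY NAME (`open … (…)` below).  At `χ := chiβOfRecord₁₃ θ` every statement here is
DEFINITIONALLY the landed one ([Ax-3b]'s `rfl` receipts); at `χ := chiβOfRecord₁₃Ax θ` it is what the Ax-record's N11 machine reads.  Nothing of record edited (body-freeze №460 (2)).

HONEST FRAMING.  Count-neutral kernel re-elaboration of landed N11 bookkeeping∕estimates in a parameter; every HYPOTHESIS of the original stays a hypothesis; nothing of
Bałaban asserted beyond what the original file proves; N11 NOT discharged; K-items untouched; counts unmoved.  One finite `𝕋⁴_{L^K}` programme at fixed `ε = L^{−K}` —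
NOT ℝ⁴, NOT OS, NOT a mass gap, NOT Clay.  No `sorry`∕`instance`∕`notation`.  Sources: as the original module, plus [I] = [Balaban1987RG1] (2.9) p.266 (the cut-off's centre).
-/

noncomputable section

open MeasureTheory
open scoped BigOperators ENNReal NNReal Matrix.Norms.L2Operator

namespace Summit.QuantumFields.YangMills.Theorems.BalabanUVNodesN11GaussianCertificateDefsChi

open Summit.QuantumFields.YangMills.Theorems.BalabanUVNodesN11GaussianCertificateDefs (gaussPinH_toStage13RParams gaussPinH_toStage13Params gaussPinH_Phih gaussPinH_quad rePinH_gaussPinH gaussPinH_rePinH gaussPinH_gaussPinH exists_gaussPinH_of_exists provisos₁₃CoPH_gaussPinH exists_local_witness_clause_succ_gaussPinH_of_termRows noExpansionTStepAt_gaussPinH_of_operandRows)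
open Literature.MathematicalPhysics.QuantumFieldTheory.Balaban1983to89 T4Continuum Node00 Node00.Tk
open B10Eq42TorusConstraint (bondsIn)
open B15DeterminingSets (MSField)
open BalabanUVNodesN11RePinnedParamDefs hiding rePinH zhAt_rePinH zhAt_rePinH_eq_init_of_Omega_empty zhAt_rePinH_ζ0_univ_pairCfgAt zhUnity_rePinH
open BalabanUVNodesN11RePinnedParamDefsChi
open BalabanUVNodesN11HistoryPinnedResidualDefsChi (ZhPinOfRecord₁₃)
open BalabanUVNodesN11FluctTruncationDefs (IsFluctLocal)
open BalabanUVNodesN11Sect3SupplyDefs (NoExpansionTStepAt)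
open BalabanUVNodesN11GaussianCertificateRows hiding coercive_of_gaussCert measurable_quad_of_gaussCert measurable_ζ0_of_gaussCert prefix_agree_of_gaussCert quad_empty_pairCfgAt_of_gaussCert quad_local_of_gaussCert zhAt_quad_apply zhAt_ζ0_eq_rePinH zhUnity_of_gaussCert ζ0_pin_of_gaussCert
open BalabanUVNodesN11GaussianCertificateRowsChi

variable {F : T4Family} {N : ℕ} [NeZero N]

section Def

variable (θ : Stage13HParams F N) (χ : ChiSlot F N)

/-- **THE GAUSSIAN CERTIFICATE OF A v1.7 PARAMETER**: `θ` with its history-indexed residual 𝐓-weight slot replaced by (dag-n11-d's certificate factor `ζ0`, THE GAUSSIAN OF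
THE INTEGRATED VARIABLES as `quad`) — every other field unchanged.  The named member of the class of `…N11GaussianCertificateRows`.
[cite: Balaban1988Convergent, (2.21) p.258, (3.16)–(3.20) pp.268–269; Balaban1987RG1, (1.4)–(1.5) pp.260–261] -/
def gaussPinH : Stage13HParams F N :=
  ⟨θ.toStage13RParams,
    fun p _ Ω Λ => ⟨(ZhPinOfRecord₁₃ θ.toStage13Params χ p Ω Λ).ζ0,
      fun j Λ' ω => ∑ b ∈ (Set.toFinite (bondsIn j (Λ'ᶜ ∩ Ω (j + 1)))).toFinset, ‖(ω j).2 b‖ ^ 2⟩,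
    θ.Phih⟩

/-- The class hypothesis `hζ` at the named witness: its residual factor is the certificate's (`rfl`). [cite: Balaban1988Convergent, (3.16)–(3.20) pp.268–269 (bookkeeping)] -/
theorem gaussPinH_ζ0 : ∀ (p : B12.RunParams) (n : ℕ) (Ω Λ : ℕ → Set (Site (F.P p.K) 0)),
    ((gaussPinH θ χ).Zh p n Ω Λ).ζ0 = (ZhPinOfRecord₁₃ (gaussPinH θ χ).toStage13Params χ p Ω Λ).ζ0 := fun _ _ _ _ => rfl

end Def

section Antecedent

variable {θ χ : Stage13HParams F N} {χ : ChiSlot F N}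

/-- **★ THE K⁷ ANTECEDENT TRANSFERS TO THE GAUSSIAN CERTIFICATE** (as dag-n11-d's `antecedent_rePinH`; `ZhUnity` unconditional): `…GaussianCertificateRows.exists_gaussCert_of_antecedent`
builds exactly `gaussPinH θ`. [cite: Balaban1988Convergent, Thm 1 p.262, (3.16)–(3.22) pp.268–269 (bookkeeping)] -/
theorem antecedent_gaussPinH (h : θ.Provisos₁₃SepCoPHChi F N χ) (hnd : θ.SlotsNondegenerate₁₃Chi F N χ) (hadm : θ.Admissible F N) :
    (gaussPinH θ χ).Provisos₁₃SepCoPHChi F N χ ∧ ((gaussPinH θ χ).ZhUnity F N ∧ (gaussPinH θ χ).SlotsNondegenerate₁₃Chi F N χ) ∧ (gaussPinH θ χ).Admissible F N := by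
  refine ⟨?_, ⟨zhUnity_of_gaussCert (gaussPinH θ χ) χ (gaussPinH_ζ0 θ χ), hnd⟩, hadm⟩
  exact
    { intPiece := h.intPiece
      measω := h.measω
      measChi := h.measChi
      zetaUnity := h.zetaUnity
      zetaAbs := h.zetaAbs
      zetaMeas := h.zetaMeas
      rstep := fun p k _ hk => h.rstep p k hk
      rzLaws := h.rzLaws
      zhLaws := fun p _ Ω Λ =>
        ⟨(BalabanUVNodesN11HistoryPinnedResidualDefsChi.laws_ZhPinOfRecord₁₃ (θ := θ.toStage13Params) (χ := χ) (p := p) h.zetaUnity Ω Λ).zeta0_nonneg⟩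
      zhLocal := fun p _ Ω Λ =>
        ⟨(BalabanUVNodesN11HistoryPinnedResidualDefsChi.localLaws_ZhPinOfRecord₁₃ (θ := θ.toStage13Params) (χ := χ) (p := p) Ω Λ).zeta0_local⟩
      hM := h.hM
      hM₁ := h.hM₁
      bg := h.bg }

end Antecedent

section Step

variable (θ : Stage13HParams F N) (χ : ChiSlot F N) (p : B12.RunParams)

end Step

/-! ## v1.1 (APPEND-ONLY; dag-n11-d g44, N11-σ chain): the remaining cone declarations of this module in χ — every v1 declaration above is byte-identical -/

section V11Append

open Summit.QuantumFields.YangMills.Theorems.BalabanUVNodesN11GaussianCertificateDefs (gaussPinH_toStage13RParams gaussPinH_toStage13Params gaussPinH_Phih rePinH_gaussPinH gaussPinH_rePinH gaussPinH_gaussPinH exists_gaussPinH_of_exists provisos₁₃CoPH_gaussPinH exists_local_witness_clause_succ_gaussPinH_of_termRows noExpansionTStepAt_gaussPinH_of_operandRows)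

section
variable {F : T4Family} {N : ℕ} [NeZero N]
variable (θ : Stage13HParams F N) (χ : ChiSlot F N)

/-- The class hypothesis `hq` at the named witness: its form is the Gaussian of the integrated variables (`rfl`). [cite: Balaban1988Convergent, (2.21) p.258 (bookkeeping)] -/
theorem gaussPinH_quad : ∀ (p : B12.RunParams) (n : ℕ) (Ω Λ : ℕ → Set (Site (F.P p.K) 0)) (j : ℕ) (Λ' : Set (Site (F.P p.K) 0))
    (ω : MultiCfg (F.P p.K) (SU N) (FluctV N)),
    ((gaussPinH θ χ).Zh p n Ω Λ).quad j Λ' ω = ∑ b ∈ (Set.toFinite (bondsIn j (Λ'ᶜ ∩ Ω (j + 1)))).toFinset, ‖(ω j).2 b‖ ^ 2 := fun _ _ _ _ _ _ _ => rfl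

end

end V11Append

end Summit.QuantumFields.YangMills.Theorems.BalabanUVNodesN11GaussianCertificateDefsChi

end
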